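import Summits.QuantumFields.YangMills.Theses.EquipartitionCriticality
import Summits.QuantumFields.YangMills.Theses.RandomConstraintAnnealing
import Summits.QuantumFields.YangMills.Theses.ModularSelfDualFold
import Summits.QuantumFields.YangMills.Theses.ConvexGribovBody
import Literature.MathematicalPhysics.QuantumLattice.WilsonBlockHeatBathLightCone2

/-!
# The sibling funnel of crux stmt-QuantumFields-8761 `LatticeGapLargeBeta`: which lattice-gap items of
# `YangMills` it is equivalent to, and which it implies (pure logic + the a priori bound)

Support file for crux stmt-QuantumFields-8761
(`Summit.QuantumFields.YangMills.Theses.EquipartitionCriticality.LatticeGapLargeBeta`, shared verbatim by route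
`DirichletWindow`: for every compact simple `G` and faithful `r`, a threshold `β₁`, a rate function `m(β) > 0`
and a volume threshold `S₀(β)` such that every pair of species `A, B` has ONE constant `C(A,B)`, uniform in
`β ≥ β₁`, with `|⟨A τ_n B⟩ − ⟨A⟩⟨B⟩| ≤ C e^{−m(β) n}` on every torus `(2S+1)⁴`, `S ≥ S₀(β)`, `n ≤ S`).

Three other OPEN statement items of this sub-problem assert a weak-coupling lattice gap in the same vocabulary
(`latticeConnectedCorr`, `YMSpecies`) with differently placed quantifiers.  This file settles, kernel-checked,
how they relate to the crux, so that a proof (or refutation) of any one of them is transported mechanically: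

* `latticeGapLargeBeta_iff_tubeGapLatticeLeg` — item stmt-QuantumFields-8715
  (`RandomConstraintAnnealing.TubeGapLatticeLeg`, that route's TARGET) differs only in the order of the binders
  `∀ S n, S₀ β ≤ S → n ≤ S →` vs `∀ S, S₀ β ≤ S → ∀ n, n ≤ S →` (grounder g15-10's evidence note, now landed).
* `latticeGapLargeBeta_iff_weakCouplingLatticeGap` — item stmt-QuantumFields-8901
  (`ModularSelfDualFold.WeakCouplingLatticeGap`) has a PAIR-dependent, `β`-independent volume threshold
  `S₀(A,B)` where the crux has a pair-independent, `β`-dependent `S₀(β)`, and arbitrary Borel instances where the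
  crux fixes `borel G`.  The two are EQUIVALENT: in either direction the small tori are absorbed into the pair
  constant after capping the rate (`m ↦ min(m, 1)`, resp. `m ↦ min(m, 1/(S₀(β)+1))`), using only the a priori
  bound `|corr| ≤ 2‖A‖∞‖B‖∞` (`WilsonBlockHeatBath.abs_latticeConnectedCorr_le_two_mul`); the rate function is
  existential in both statements, so nothing is lost.
* `uniformLatticeGap_of_latticeGapLargeBeta` — item stmt-QuantumFields-8778 (`ConvexGribovBody.UniformLatticeGap`,
  the TARGET of routes `ConvexGribovBody`, `SmallCircleAnchor`, `ContractibleFibre`) allows `β`-DEPENDENT pair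
  constants and is therefore implied by the crux (the converse is not formal: per-`β` pair constants cannot be
  made `β`-uniform without a pair-uniform control of `C(A,B,β)`).

(Route `DirichletWindow`'s `LatticeGapLargeBeta` is the same item and the same term, so `Iff.rfl` relates them;
`FradkinShenkerFlow.FiniteSusceptibilityWeakCoupling`, stmt-QuantumFields-9442, is already served by
`FiniteSusceptibilityWeakCoupling.SiblingFunnel.finiteSusceptibilityWeakCoupling_of_latticeGapLargeBeta`;
`GronwallGap.LatticeGapOffTransitions`, stmt-QuantumFields-8799, is incomparable: it also speaks about small and
intermediate `β` and has `β`-dependent pair constants.)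

No definition is introduced and no named fact is used; all statements are existing route declarations.
-/

noncomputable section

open MeasureTheory
open Literature.MathematicalPhysics.QuantumFieldTheory Literature.MathematicalPhysics.QuantumLattice

namespace Summit.QuantumFields.YangMills.Theorems.LatticeGapLargeBeta.SiblingFunnel

/-! ### Two elementary absorptions of small tori into the pair constant -/

/-- **Capping the rate at `1` absorbs a pair-dependent volume threshold.**  If a sequence of numbers
`c β S n` (think `|corr_{β,2S+1}(A,B,n)|`) is bounded a priori by `D ≥ 0` and, for `S ≥ S₀` and `n ≤ S`, by
`C e^{−m(β) n}`, then for ALL `S` and `n ≤ S` it is bounded by `(|C| + D e^{S₀}) e^{−min(m(β),1) n}`. [folklore] -/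
theorem bound_capOne {c : ℝ → ℕ → ℕ → ℝ} {m : ℝ → ℝ} {C D : ℝ} {S₀ : ℕ} (hD : 0 ≤ D)
    (hap : ∀ β S n, c β S n ≤ D)
    (hcl : ∀ β S n, S₀ ≤ S → n ≤ S → c β S n ≤ C * Real.exp (-(m β * n))) :
    ∀ β S n, n ≤ S → c β S n ≤ (|C| + D * Real.exp S₀) * Real.exp (-(min (m β) 1 * n)) := by
  intro β S n hn
  have hE : 0 < Real.exp (-(min (m β) 1 * n)) := Real.exp_pos _
  rcases le_or_gt S₀ S with hS | hS
  · -- large torus: the clustering bound, with the rate lowered to `min (m β) 1`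
    have h1 := hcl β S n hS hn
    have hCpos : C * Real.exp (-(m β * n)) ≤ |C| * Real.exp (-(min (m β) 1 * n)) := by
      have : C * Real.exp (-(m β * n)) ≤ |C| * Real.exp (-(m β * n)) :=
        mul_le_mul_of_nonneg_right (le_abs_self C) (Real.exp_pos _).le
      refine this.trans (mul_le_mul_of_nonneg_left ?_ (abs_nonneg C))
      exact Real.exp_le_exp.mpr (neg_le_neg (mul_le_mul_of_nonneg_right (min_le_left _ _) (Nat.cast_nonneg n)))
    calc c β S n ≤ |C| * Real.exp (-(min (m β) 1 * n)) := h1.trans hCpos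
      _ ≤ (|C| + D * Real.exp S₀) * Real.exp (-(min (m β) 1 * n)) := by
          refine mul_le_mul_of_nonneg_right ?_ hE.le
          have : 0 ≤ D * Real.exp S₀ := mul_nonneg hD (Real.exp_pos _).le
          linarith
  · -- small torus `S < S₀`: `n ≤ S < S₀` and `min (m β) 1 * n ≤ n ≤ S₀`, so the a priori bound suffices
    have hnS₀ : (n : ℝ) ≤ S₀ := by exact_mod_cast (hn.trans hS.le)
    have hrate : min (m β) 1 * n ≤ (S₀ : ℝ) := by
      rcases le_or_gt 0 (min (m β) 1) with h0 | h0
      · exact (mul_le_of_le_one_left (Nat.cast_nonneg n) (min_le_right _ _)).trans hnS₀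
      · exact ((mul_nonpos_of_nonpos_of_nonneg h0.le (Nat.cast_nonneg n))).trans (Nat.cast_nonneg S₀)
    have h2 : D ≤ D * Real.exp S₀ * Real.exp (-(min (m β) 1 * n)) := by
      rw [mul_assoc, ← Real.exp_add]
      have : 1 ≤ Real.exp (S₀ + -(min (m β) 1 * n)) := Real.one_le_exp (by linarith)
      nlinarith
    calc c β S n ≤ D := hap β S n
      _ ≤ D * Real.exp S₀ * Real.exp (-(min (m β) 1 * n)) := h2
      _ ≤ (|C| + D * Real.exp S₀) * Real.exp (-(min (m β) 1 * n)) := by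
          rw [add_mul]
          have : 0 ≤ |C| * Real.exp (-(min (m β) 1 * n)) := mul_nonneg (abs_nonneg C) hE.le
          linarith

/-- **Capping the rate at `1/(S₀(β)+1)` absorbs a `β`-dependent volume threshold.**  If `c β S n` is bounded
a priori by `D ≥ 0` and, for `S ≥ S₀ β` and `n ≤ S`, by `C e^{−m(β) n}`, then for ALL `S` and `n ≤ S` it is
bounded by `(|C| + D e) e^{−min(m(β), 1/(S₀ β + 1)) n}` — a `β`-UNIFORM constant. [folklore] -/
theorem bound_capThreshold {c : ℝ → ℕ → ℕ → ℝ} {m : ℝ → ℝ} {C D : ℝ} {S₀ : ℝ → ℕ} (hD : 0 ≤ D)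
    (hap : ∀ β S n, c β S n ≤ D)
    (hcl : ∀ β S n, S₀ β ≤ S → n ≤ S → c β S n ≤ C * Real.exp (-(m β * n))) :
    ∀ β S n, n ≤ S →
      c β S n ≤ (|C| + D * Real.exp 1) * Real.exp (-(min (m β) (1 / ((S₀ β : ℝ) + 1)) * n)) := by
  intro β S n hn
  set μ : ℝ := min (m β) (1 / ((S₀ β : ℝ) + 1)) with hμ
  have hE : 0 < Real.exp (-(μ * n)) := Real.exp_pos _
  rcases le_or_gt (S₀ β) S with hS | hS
  · have h1 := hcl β S n hS hn
    have hCpos : C * Real.exp (-(m β * n)) ≤ |C| * Real.exp (-(μ * n)) := by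
      have : C * Real.exp (-(m β * n)) ≤ |C| * Real.exp (-(m β * n)) :=
        mul_le_mul_of_nonneg_right (le_abs_self C) (Real.exp_pos _).le
      refine this.trans (mul_le_mul_of_nonneg_left ?_ (abs_nonneg C))
      exact Real.exp_le_exp.mpr (neg_le_neg (mul_le_mul_of_nonneg_right (min_le_left _ _) (Nat.cast_nonneg n)))
    calc c β S n ≤ |C| * Real.exp (-(μ * n)) := h1.trans hCpos
      _ ≤ (|C| + D * Real.exp 1) * Real.exp (-(μ * n)) := by
          refine mul_le_mul_of_nonneg_right ?_ hE.le
          have : 0 ≤ D * Real.exp 1 := mul_nonneg hD (Real.exp_pos _).le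
          linarith
  · -- small torus `S < S₀ β`: `μ n ≤ n/(S₀ β + 1) ≤ 1`
    have hpos : (0 : ℝ) < (S₀ β : ℝ) + 1 := by positivity
    have hnS₀ : (n : ℝ) ≤ (S₀ β : ℝ) + 1 := by
      have : (n : ℝ) ≤ S₀ β := by exact_mod_cast (hn.trans hS.le)
      linarith
    have hrate : μ * n ≤ 1 := by
      rcases le_or_gt 0 μ with h0 | h0
      · calc μ * n ≤ (1 / ((S₀ β : ℝ) + 1)) * ((S₀ β : ℝ) + 1) :=
              mul_le_mul (min_le_right _ _) hnS₀ (Nat.cast_nonneg n) (by positivity)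
          _ = 1 := by field_simp
      · exact (mul_nonpos_of_nonpos_of_nonneg h0.le (Nat.cast_nonneg n)).trans zero_le_one
    have h2 : D ≤ D * Real.exp 1 * Real.exp (-(μ * n)) := by
      rw [mul_assoc, ← Real.exp_add]
      have : 1 ≤ Real.exp (1 + -(μ * n)) := Real.one_le_exp (by linarith)
      nlinarith
    calc c β S n ≤ D := hap β S n
      _ ≤ D * Real.exp 1 * Real.exp (-(μ * n)) := h2
      _ ≤ (|C| + D * Real.exp 1) * Real.exp (-(μ * n)) := by
          rw [add_mul]
          have : 0 ≤ |C| * Real.exp (-(μ * n)) := mul_nonneg (abs_nonneg C) hE.le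
          linarith

/-! ### The funnel -/

/-- **Crux 8761 ⇔ item stmt-QuantumFields-8715** (`RandomConstraintAnnealing.TubeGapLatticeLeg`, the target of
route `RandomConstraintAnnealing`): the two statements differ only in the order of the binders
`∀ S n, S₀ β ≤ S → n ≤ S → …` versus `∀ S, S₀ β ≤ S → ∀ n, n ≤ S → …`.  Either item closes the other. [folklore] -/
theorem latticeGapLargeBeta_iff_tubeGapLatticeLeg :
    Summit.QuantumFields.YangMills.Theses.EquipartitionCriticality.LatticeGapLargeBeta ↔
      Summit.QuantumFields.YangMills.Theses.RandomConstraintAnnealing.TubeGapLatticeLeg := by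
  constructor
  · intro h G _ _ _ _ hG r
    obtain ⟨β₁, m, S₀, hm, hAB⟩ := h G hG r
    refine ⟨β₁, m, S₀, hm, fun A B => ?_⟩
    obtain ⟨C, hC⟩ := hAB A B
    exact ⟨C, fun β hβ S hS n hn => hC β hβ S n hS hn⟩
  · intro h G _ _ _ _ hG r
    obtain ⟨β₀, m, S₀, hm, hAB⟩ := h G hG r
    refine ⟨β₀, m, S₀, hm, fun A B => ?_⟩
    obtain ⟨C, hC⟩ := hAB A B
    exact ⟨C, fun β hβ S n hS hn => hC β hβ S hS n hn⟩

/-- **Crux 8761 ⇒ item stmt-QuantumFields-8778** (`ConvexGribovBody.UniformLatticeGap`, target of the routes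
`ConvexGribovBody`, `SmallCircleAnchor`, `ContractibleFibre`): per-`β` rate, volume threshold and pair constants
are a fortiori supplied by the crux's `β`-uniform ones; the arbitrary Borel structure of 8778 is the crux's
`borel G` by `BorelSpace.measurable_eq`. [folklore] -/
theorem uniformLatticeGap_of_latticeGapLargeBeta :
    Summit.QuantumFields.YangMills.Theses.EquipartitionCriticality.LatticeGapLargeBeta →
      Summit.QuantumFields.YangMills.Theses.ConvexGribovBody.UniformLatticeGap := by
  intro h G _ _ _ _ _ iB hG r
  obtain ⟨hmeas⟩ := iB
  subst hmeas
  letI : MeasurableSpace G := borel G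
  haveI : BorelSpace G := ⟨rfl⟩
  obtain ⟨β₁, m, S₀, hm, hAB⟩ := h G hG r
  refine ⟨β₁, fun β hβ => ⟨m β, hm β hβ, S₀ β, fun A B => ?_⟩⟩
  obtain ⟨C, hC⟩ := hAB A B
  exact ⟨C, fun S n hS hn => hC β hβ S n hS hn⟩

/-- **Crux 8761 ⇔ item stmt-QuantumFields-8901** (`ModularSelfDualFold.WeakCouplingLatticeGap`).  8901 has a
pair-dependent, `β`-independent volume threshold `S₀(A,B)` and arbitrary Borel instances; the crux has a
pair-independent, `β`-dependent `S₀(β)` and fixes `borel G`.  Forward: cap the crux's rate at `1/(S₀(β)+1)`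
(`bound_capThreshold`) — then NO volume threshold is needed and the constant `|C| + 2‖A‖‖B‖e` is still
`β`-uniform.  Backward: cap 8901's rate at `1` (`bound_capOne`) — then the tori `S < S₀(A,B)` cost a factor
`e^{S₀(A,B)}` in the pair constant and the crux holds with `S₀(β) = 0`.  Either item closes the other. [folklore] -/
theorem latticeGapLargeBeta_iff_weakCouplingLatticeGap :
    Summit.QuantumFields.YangMills.Theses.EquipartitionCriticality.LatticeGapLargeBeta ↔
      Summit.QuantumFields.YangMills.Theses.ModularSelfDualFold.WeakCouplingLatticeGap := by
  constructor
  · intro h G _ _ _ _ _ iB hG r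
    obtain ⟨hmeas⟩ := iB
    subst hmeas
    letI : MeasurableSpace G := borel G
    haveI : BorelSpace G := ⟨rfl⟩
    obtain ⟨β₁, m, S₀, hm, hAB⟩ := h G hG r
    refine ⟨β₁, fun β => min (m β) (1 / ((S₀ β : ℝ) + 1)), fun β hβ => lt_min (hm β hβ) (by positivity),
      fun A B => ?_⟩
    obtain ⟨C, hC⟩ := hAB A B
    obtain ⟨a, ha⟩ := A.bounded
    obtain ⟨b, hb⟩ := B.bounded
    have ha0 : 0 ≤ a := (abs_nonneg _).trans (ha fun _ => 1)
    have hb0 : 0 ≤ b := (abs_nonneg _).trans (hb fun _ => 1)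
    -- the correlation as a function of (β, S, n), extended by 0 below the threshold β₁
    let c : ℝ → ℕ → ℕ → ℝ := fun β S n =>
      if β₁ ≤ β then |latticeConnectedCorr r.ρ β (2 * S + 1) A.F B.F n| else 0
    have hap : ∀ β S n, c β S n ≤ 2 * (a * b) := fun β S n => by
      simp only [c]; split_ifs
      · exact WilsonBlockHeatBath.abs_latticeConnectedCorr_le_two_mul r β (2 * S + 1) ha hb n
      · positivity
    have hcl : ∀ β S n, S₀ β ≤ S → n ≤ S → c β S n ≤ C * Real.exp (-(m β * n)) := fun β S n hS hn => by
      simp only [c]; split_ifs with hβ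
      · exact hC β hβ S n hS hn
      · -- below threshold the extension is 0 and `C ≥ 0` (from the instance `β₁, S₀ β₁, 0`)
        have hC0 : 0 ≤ C := by
          have := hC β₁ le_rfl (S₀ β₁) 0 le_rfl (Nat.zero_le _)
          simp only [Nat.cast_zero, mul_zero, neg_zero, Real.exp_zero, mul_one] at this
          exact (abs_nonneg _).trans this
        positivity
    have key := bound_capThreshold (c := c) (m := m) (C := C) (S₀ := S₀) (by positivity) hap hcl
    refine ⟨|C| + 2 * (a * b) * Real.exp 1, 0, fun β hβ S _ n hn => ?_⟩
    have := key β S n hn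
    simp only [c, if_pos hβ] at this
    exact this
  · intro h G _ _ _ _ hG
    letI : MeasurableSpace G := borel G
    haveI : BorelSpace G := ⟨rfl⟩
    intro r
    obtain ⟨β₁, m, hm, hAB⟩ := h G hG r
    refine ⟨β₁, fun β => min (m β) 1, fun _ => 0, fun β hβ => lt_min (hm β hβ) one_pos, fun A B => ?_⟩
    obtain ⟨C, S₀, hC⟩ := hAB A B
    obtain ⟨a, ha⟩ := A.bounded
    obtain ⟨b, hb⟩ := B.bounded
    have ha0 : 0 ≤ a := (abs_nonneg _).trans (ha fun _ => 1)
    have hb0 : 0 ≤ b := (abs_nonneg _).trans (hb fun _ => 1)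
    let c : ℝ → ℕ → ℕ → ℝ := fun β S n =>
      if β₁ ≤ β then |latticeConnectedCorr r.ρ β (2 * S + 1) A.F B.F n| else 0
    have hap : ∀ β S n, c β S n ≤ 2 * (a * b) := fun β S n => by
      simp only [c]; split_ifs
      · exact WilsonBlockHeatBath.abs_latticeConnectedCorr_le_two_mul r β (2 * S + 1) ha hb n
      · positivity
    have hcl : ∀ β S n, S₀ ≤ S → n ≤ S → c β S n ≤ C * Real.exp (-(m β * n)) := fun β S n hS hn => by
      simp only [c]; split_ifs with hβ
      · exact hC β hβ S hS n hn
      · have hC0 : 0 ≤ C := by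
          have := hC β₁ le_rfl S₀ le_rfl 0 (Nat.zero_le _)
          simp only [Nat.cast_zero, mul_zero, neg_zero, Real.exp_zero, mul_one] at this
          exact (abs_nonneg _).trans this
        positivity
    have key := bound_capOne (c := c) (m := m) (C := C) (S₀ := S₀) (by positivity) hap hcl
    refine ⟨|C| + 2 * (a * b) * Real.exp S₀, fun β hβ S n _ hn => ?_⟩
    have := key β S n hn
    simp only [c, if_pos hβ] at this
    exact this

end Summit.QuantumFields.YangMills.Theorems.LatticeGapLargeBeta.SiblingFunnel

end
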